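import Literature.MathematicalPhysics.QuantumLattice.InfVolFermionStateCompactness
import Literature.MathematicalPhysics.QuantumLattice.TorusSectorGibbsMixture
import HarnessLib

/-!
# Weak-⋆ compactness for translation-averaged MIXTURES of torus vectors: thermal torus-limit states exist

Topic `Literature/MathematicalPhysics/QuantumLattice`; the mixture form of
`InfVolFermionStateCompactness.lean` (`InfVolFermionState.exists_isTorusLimitOf_subseq`: pure families).
For finite mixtures `(p_{L,i}, ψ_{L,i})_{i < m L}` of unit vectors with probability weights — e.g. the
canonical Gibbs states of the `t–t'` Hubbard tori (`TorusSectorGibbsMixture.lean`) — every side sequence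
`Ls → ∞` has a subsequence along which the weighted translation-averaged expectations of EVERY local
observable converge to the expectations of an infinite-volume state:
`InfVolFermionState.exists_isTorusLimitOfMixture_subseq` (same Cantor–Tychonoff argument on the
matrix-unit coordinates, each bounded by `Σ_i p_i · 1 = 1`). By name for the canonical sector Gibbs data
(`exists_isTorusLimitOfMixture_sectorGibbs_subseq`): thermal torus-limit states EXIST along a subsequence
of every `Ls → ∞`, for every `β, t, t', U` and `0 ≤ n ≤ 2` — the non-vacuity of the hypotheses of the
thermal reader (`HubbardTTPrimeThermalWindowCertificate*.lean`) and the first half of the passage from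
torus-limit bounds to `∀ᶠ L` / `limsup` statements about finite tori. Everything is PROVED; no definition,
no named fact. (History: the first version of
this file, p463795 by prover-hubbard-downfold-unc-3, proved `exists_isTorusLimitOfMixture_subseq` with the same
signature, `IsTorusLimitOfMixture.comp_tendsto` and `…_of_isNParticle`; p470026 re-proved the first and added the
sector-Gibbs corollary but inadvertently dropped the other two, restored here byte-for-byte in statement.)

References: Bratteli–Robinson I Thm. 2.3.15 (weak-⋆ compactness of the state space), §4.3.1
[BratteliRobinsonI1987]; Israel 1979 §III.1 (limits of periodic-b.c. Gibbs states) [Israel1979].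
-/

noncomputable section

namespace Literature.MathematicalPhysics.QuantumLattice

open Matrix Finset HubbardWave0 Literature.Probability.LatticeModels ThermodynamicLimit
open _root_.Filter
open scoped _root_.Topology ComplexOrder BigOperators

section Compactness

variable {d : ℕ}

/-- **Thermodynamic-limit states of mixtures exist (weak-⋆ compactness).** For every family of finite
mixtures `(p L i, ψ L i)_{i : Fin (m L)}` of torus vectors and every side sequence `Ls → ∞` along which
the weights are nonnegative with sum `1` and the components are unit vectors, there are a subsequence
`Ls ∘ φ` and an infinite-volume state `ω` with `ω.IsTorusLimitOfMixture m p ψ (Ls ∘ φ)`.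
[cite: BratteliRobinsonI1987, Thm. 2.3.15 (weak-⋆ compactness of the state space) and §4.3.1] -/
theorem InfVolFermionState.exists_isTorusLimitOfMixture_subseq {m : ℕ → ℕ} (p : ∀ L, Fin (m L) → ℝ)
    (ψ : ∀ L, Fin (m L) → Fock (Orb (FermionTorus d L))) {Ls : ℕ → ℕ} (hLs : Tendsto Ls atTop atTop)
    (hp0 : ∀ j i, 0 ≤ p (Ls j) i) (hp1 : ∀ j, ∑ i, p (Ls j) i = 1)
    (hψ : ∀ j i, star (ψ (Ls j) i) ⬝ᵥ ψ (Ls j) i = 1) :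
    ∃ φ : ℕ → ℕ, StrictMono φ ∧ ∃ ω : InfVolFermionState d, ω.IsTorusLimitOfMixture m p ψ (Ls ∘ φ) := by
  -- coordinates: the weighted values on the matrix units `|s⟩⟨t|` of all local algebras
  let c : ℕ → (Σ Λ : Finset (Site d), Finset (Orb (PolySite Λ)) × Finset (Orb (PolySite Λ))) → ℂ :=
    fun j ι => ∑ i, (p (Ls j) i : ℂ) * torusAvgExpect (Ls j) ι.1 (Matrix.single ι.2.1 ι.2.2 (1 : ℂ)) (ψ (Ls j) i)
  have hK : IsCompact (Set.pi Set.univ fun _ :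
      (Σ Λ : Finset (Site d), Finset (Orb (PolySite Λ)) × Finset (Orb (PolySite Λ))) =>
        Metric.closedBall (0 : ℂ) 1) :=
    isCompact_univ_pi fun _ => isCompact_closedBall (0 : ℂ) 1
  have hc : ∀ j, c j ∈ Set.pi Set.univ fun _ :
      (Σ Λ : Finset (Site d), Finset (Orb (PolySite Λ)) × Finset (Orb (PolySite Λ))) =>
        Metric.closedBall (0 : ℂ) 1 := fun j ι _ => by
    rw [Metric.mem_closedBall, dist_zero_right]
    calc ‖∑ i, (p (Ls j) i : ℂ) * torusAvgExpect (Ls j) ι.1 (Matrix.single ι.2.1 ι.2.2 (1 : ℂ)) (ψ (Ls j) i)‖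
        ≤ ∑ i, ‖(p (Ls j) i : ℂ) * torusAvgExpect (Ls j) ι.1 (Matrix.single ι.2.1 ι.2.2 (1 : ℂ)) (ψ (Ls j) i)‖ :=
          norm_sum_le _ _
      _ ≤ ∑ i, p (Ls j) i := Finset.sum_le_sum fun i _ => by
          rw [norm_mul, Complex.norm_real, Real.norm_of_nonneg (hp0 j i)]
          exact mul_le_of_le_one_right (hp0 j i) (norm_torusAvgExpect_single_le _ _ _ _ (hψ j i))
      _ = 1 := hp1 j
  obtain ⟨g, -, φ, hφ, hg⟩ := hK.tendsto_subseq hc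
  have hcoord : ∀ ι : (Σ Λ : Finset (Site d), Finset (Orb (PolySite Λ)) × Finset (Orb (PolySite Λ))),
      Tendsto (fun j => c (φ j) ι) atTop (𝓝 (g ι)) := fun ι => tendsto_pi_nhds.1 hg ι
  -- the limit functional and the convergence of all weighted averaged expectations
  let lim : ∀ Λ : Finset (Site d), FermionOp Λ → ℂ := fun Λ A => ∑ s, ∑ t, A s t * g ⟨Λ, (s, t)⟩
  have hlim : ∀ (Λ : Finset (Site d)) (A : FermionOp Λ),
      Tendsto (fun j => ∑ i, (p (Ls (φ j)) i : ℂ) * torusAvgExpect (Ls (φ j)) Λ A (ψ (Ls (φ j)) i)) atTop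
        (𝓝 (lim Λ A)) := by
    intro Λ A
    have hre : ∀ j, ∑ i, (p (Ls (φ j)) i : ℂ) * torusAvgExpect (Ls (φ j)) Λ A (ψ (Ls (φ j)) i) =
        ∑ s, ∑ t, A s t * c (φ j) ⟨Λ, (s, t)⟩ := by
      intro j
      simp only [c]
      simp_rw [torusAvgExpect_eq_sum_single _ Λ A, Finset.mul_sum]
      rw [Finset.sum_comm]
      refine Finset.sum_congr rfl fun s _ => ?_
      rw [Finset.sum_comm]
      refine Finset.sum_congr rfl fun t _ => Finset.sum_congr rfl fun i _ => ?_
      ring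
    simp_rw [hre]
    refine tendsto_finsetSum _ fun s _ => tendsto_finsetSum _ fun t _ => ?_
    exact (hcoord ⟨Λ, (s, t)⟩).const_mul _
  have hLφ : Tendsto (Ls ∘ φ) atTop atTop := hLs.comp hφ.tendsto_atTop
  -- the limit functional is linear
  let E : ∀ Λ : Finset (Site d), FermionOp Λ →ₗ[ℂ] ℂ := fun Λ =>
    { toFun := lim Λ
      map_add' := fun A B => by
        simp only [lim, Matrix.add_apply, add_mul, Finset.sum_add_distrib]
      map_smul' := fun a A => by
        simp only [lim, Matrix.smul_apply, smul_eq_mul, mul_assoc, Finset.mul_sum, RingHom.id_apply] }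
  -- normalisation
  have h_one : ∀ Λ : Finset (Site d), E Λ 1 = 1 := by
    intro Λ
    refine tendsto_nhds_unique (hlim Λ 1) ?_
    refine (tendsto_const_nhds (x := (1 : ℂ))).congr' ?_
    filter_upwards [eventually_injOn_proj_of_tendsto Λ hLφ, hLφ.eventually_ge_atTop 1] with j hj hj1
    haveI : NeZero (Ls (φ j)) := ⟨Nat.one_le_iff_ne_zero.1 hj1⟩
    have h1 : ∀ i, torusAvgExpect (Ls (φ j)) Λ 1 (ψ (Ls (φ j)) i) = 1 := fun i =>
      torusAvgExpect_one (Ls (φ j)) hj (hψ (φ j) i)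
    simp_rw [h1, mul_one]
    rw [← Complex.ofReal_sum, hp1 (φ j), Complex.ofReal_one]
  -- positivity
  have h_nonneg : ∀ (Λ : Finset (Site d)) (A : FermionOp Λ), 0 ≤ E Λ (Aᴴ * A) := fun Λ A =>
    ge_of_tendsto' (hlim Λ (Aᴴ * A)) fun j => Finset.sum_nonneg fun i _ =>
      mul_nonneg (Complex.zero_le_real.2 (hp0 (φ j) i)) (torusAvgExpect_conjTranspose_mul_self_nonneg _ _ _ _)
  -- compatibility
  have h_comp : ∀ ⦃Λ Λ' : Finset (Site d)⦄ (h : Λ ⊆ Λ') (A : FermionOp Λ),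
      E Λ' (fermionEmbed (PolySite.incl h) A) = E Λ A := by
    intro Λ Λ' h A
    refine tendsto_nhds_unique (hlim Λ' (fermionEmbed (PolySite.incl h) A)) ?_
    refine (hlim Λ A).congr' ?_
    filter_upwards [eventually_injOn_proj_of_tendsto Λ' hLφ] with j hj
    have hj' : Set.InjOn (Torus.proj (d := d) (Ls (φ j))) ↑Λ' := hj
    exact Finset.sum_congr rfl fun i _ => by rw [torusAvgExpect_fermionEmbed_incl _ h hj' A _]
  exact ⟨φ, hφ, ⟨E, h_one, h_nonneg, h_comp⟩, fun Λ A => hlim Λ A⟩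

/-- **Thermal torus-limit states exist.** For the canonical Gibbs data of `hubbardTorusTT' L t t' U` on
the sectors `(rectN n L, S^z = 0)` (`0 ≤ n ≤ 2`, any `β, t, t', U`) and every `Ls → ∞` there are a
subsequence `Ls ∘ φ` and an infinite-volume state `ω` which is their torus limit
(`IsTorusLimitOfMixture`; hence translation invariant, `D₄`- and spin-flip invariant, of density `n`,
satisfying the thermal rows — by the companion files). [cite: Israel1979, §I.3 eq. (26)] -/
theorem exists_isTorusLimitOfMixture_sectorGibbs_subseq (t t' U : ℝ) {n : ℝ} (hn0 : 0 ≤ n) (hn2 : n ≤ 2)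
    (β : ℝ) {Ls : ℕ → ℕ} (hLs : Tendsto Ls atTop atTop) :
    ∃ φ : ℕ → ℕ, StrictMono φ ∧ ∃ ω : InfVolFermionState 2,
      ω.IsTorusLimitOfMixture (sectorGibbsCount n) (fun L => sectorGibbsWeightTT' β t t' U n L)
        (fun L => sectorGibbsVectorTT' t t' U n L) (Ls ∘ φ) :=
  InfVolFermionState.exists_isTorusLimitOfMixture_subseq _ _ hLs
    (fun j i => sectorGibbsWeightTT'_nonneg β t t' U n (Ls j) i)
    (fun j => sum_sectorGibbsWeightTT' β t t' U hn0 hn2 (Ls j))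
    (fun j i => star_sectorGibbsVectorTT'_dotProduct_self t t' U n (Ls j) i)

/-- Mixture torus limits pass to subsequences (and to any reparametrisation tending to `∞`): if `ω`
is the torus limit along `Ls`, it is the torus limit along `Ls ∘ φ` for every `φ → ∞`. (Restored from
the first version of this file, prover-hubbard-downfold-unc-3, p463795.)
[cite: BratteliRobinsonI1987, §4.3.1 (PDF pp. 373–375)] -/
theorem InfVolFermionState.IsTorusLimitOfMixture.comp_tendsto {ω : InfVolFermionState d} {m : ℕ → ℕ}
    {p : ∀ L, Fin (m L) → ℝ} {ψ : ∀ L, Fin (m L) → Fock (Orb (FermionTorus d L))} {Ls : ℕ → ℕ}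
    (h : ω.IsTorusLimitOfMixture m p ψ Ls) {φ : ℕ → ℕ} (hφ : Tendsto φ atTop atTop) :
    ω.IsTorusLimitOfMixture m p ψ (Ls ∘ φ) := fun Λ A => (h Λ A).comp hφ

/-- **Thermodynamic-limit states of fixed-particle-number mixtures** exist along a subsequence and are
translation invariant and even (compactness + `IsTorusLimitOfMixture.isTranslationInvariant`, `.isEven`).
(Restored from the first version of this file, prover-hubbard-downfold-unc-3, p463795.)
[cite: BratteliRobinsonI1987, Thm. 2.3.15 (weak-⋆ compactness of the state space) and §4.3.1] -/
theorem InfVolFermionState.exists_isTorusLimitOfMixture_subseq_of_isNParticle {m : ℕ → ℕ}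
    (p : ∀ L, Fin (m L) → ℝ) (ψ : ∀ L, Fin (m L) → Fock (Orb (FermionTorus d L))) {N : ℕ → ℕ}
    (hN : ∀ L i, IsNParticle (N L) (ψ L i)) {Ls : ℕ → ℕ} (hLs : Tendsto Ls atTop atTop)
    (hp0 : ∀ j i, 0 ≤ p (Ls j) i) (hp1 : ∀ j, ∑ i, p (Ls j) i = 1)
    (hψ : ∀ j i, star (ψ (Ls j) i) ⬝ᵥ ψ (Ls j) i = 1) :
    ∃ φ : ℕ → ℕ, StrictMono φ ∧ ∃ ω : InfVolFermionState d,
      ω.IsTorusLimitOfMixture m p ψ (Ls ∘ φ) ∧ ω.IsTranslationInvariant ∧ ω.IsEven := by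
  obtain ⟨φ, hφ, ω, hω⟩ := InfVolFermionState.exists_isTorusLimitOfMixture_subseq p ψ hLs hp0 hp1 hψ
  exact ⟨φ, hφ, ω, hω, hω.isTranslationInvariant, hω.isEven hN⟩

end Compactness

end Literature.MathematicalPhysics.QuantumLattice

end
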